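import Summits.NavierStokesRegularity.NavierStokesRegularity.Theses.FilamentSkeletonRss
import Summits.AnomalousDissipation.AnomalousDissipation.Theorems.MarginalStabilityChainStretchedVortexRowsStubCoreInverseIntegrabilityTools
import Summits.AnomalousDissipation.AnomalousDissipation.Theorems.MarginalStabilityChainStretchedVortexRowsStubCoreBiotSavartSkew

/-!
# Route FilamentSkeletonRss · crux `CoreLinearInvertibility` (stmt-NavierStokesRegularity-17973) — line `Sketch`,
# stub `stub_coreBoundLamZero`: the `λ = 0` core bound (Gallay–Wayne energy estimate, `c = 1/2`, every `R`)

Helper file (theorems only) for the skeleton of the crux `CoreLinearInvertibility`. For the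
linearised strained planar core operator at the Gaussian vortex with NO asymmetry,
`T_{0,R} w = L w − R Λ w`, `L = Δ + ½x·∇ + 1 = strainedVorticityOperator 0`,
`Λ w = ⟪v^G, ∇w⟫ + ⟪K_{2D} ∗ w, ∇G⟫` (`gaussVortexVelocity`, `biotSavart2D`, `gaussVortexProfile`
of `Literature.Analysis.FluidPDE.GaussianVortexPlanar`), and every `C²` compactly supported
vorticity `w` of zero mass, in `X = L²(G⁻¹ dx)` (`G = gaussWeightLam 0 = gaussVortexProfile`):

  `¼ ∫ G⁻¹ w² ≤ ∫ G⁻¹ (T_{0,R} w)²`   for EVERY real `R` (`stub_coreBoundLamZero`).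

Proof (Gallay–Wayne 2005, §4: the energy method at spectral parameter `0`), in ground-state
variables `w = G u`, `u = w/G ∈ C²_c` (so `u, Du, D²u` are bounded):
* ENERGY: `⟨Lw, w⟩_X = −∫ G‖Du‖² ≤ −½ ∫ G u² = −½‖w‖²_X` (ground-state conjugation
  `G⁻¹L(Gu) = Δu − ½Du[x]` and the Gaussian Poincaré inequality on mass-zero `u`; tree:
  `coreL_energy_identity_of_bounds`, `coreL_gap_of_bounds` of the AnomalousDissipation core toolkit,
  resting on `Literature.Analysis.FluidPDE.GaussianVortexPoincare`);
* SKEWNESS of `Λ` in `X`: the local rotation `⟨v^G·∇w, w⟩_X = 0` (`v^G·∇ = Ω∂_θ` with `ΩG`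
  radial: `coreRotation_local_skew`) and the Biot–Savart part `⟨(K∗w)·∇G, w⟩_X = −½∫ w ⟪x, K∗w⟫ = 0`
  (antisymmetry of `⟪x, K(x − y)⟫` under `x ↔ y` and Fubini: `coreBiotSavart_skew`,
  Gallay–Wayne 2005, Lemma 4.8);
* hence `−⟨Tw, w⟩_X = −⟨Lw, w⟩_X ≥ ½‖w‖²_X`, and the pointwise AM–GM inequality
  `−(Tw)w ≤ (Tw)² + ¼w²` integrates to `−⟨Tw, w⟩_X ≤ ‖Tw‖²_X + ¼‖w‖²_X`; together
  `¼‖w‖²_X ≤ ‖Tw‖²_X` (no square roots).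
All pairings converge absolutely: every piece is of Gaussian class `|·| ≤ C(1+|x|)ⁿG`
(`integrable_invGauss_mul_sq`, `integrable_invGauss_mul_mul`; the Biot–Savart velocity of `w` is
bounded, `exists_norm_biotSavart2D_le_of_gaussClass`).

The ground-state toolkit is imported from the proved Theorems files
`Summits.AnomalousDissipation.AnomalousDissipation.Theorems.MarginalStabilityChainStretchedVortexRowsStubCore*`
(same operator `L`, same `Λ_G`, same weight `G⁻¹`; CONVENTIONS §2 allows `Summits.<Any>.<Problem>.Theorems.*`).

References: Th. Gallay, C. E. Wayne, *Global stability of vortex solutions of the two-dimensional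
Navier–Stokes equation*, Comm. Math. Phys. 255 (2005) 97–129, Prop. 4.1, Lemma 4.8, App. A
[GallayWayne2005]; Th. Gallay, C. E. Wayne, *Existence and stability of asymmetric Burgers
vortices*, J. Math. Fluid Mech. 9 (2007), §2 [GallayWayne2006]; Th. Gallay, Y. Maekawa,
arXiv:1610.08384, §2.2, §4.1 [GallayMaekawa2016].
-/

-- attempts log (worker W4):
--   v1: ground-state reduction `w = G u` + AnomalousDissipation core toolkit (energy gap, two skewness lemmas,
--       Gaussian-class integrability) + AM-GM.

-- the summit and its single sub-problem share the name (CONVENTIONS §1), as in every Theorems file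
set_option linter.dupNamespace false

noncomputable section

namespace Summit.NavierStokesRegularity.NavierStokesRegularity.Theorems

open MeasureTheory Filter Topology Set
open Literature.Analysis.FluidPDE
open Summit.AnomalousDissipation.AnomalousDissipation.Theorems.MarginalStabilityChainStretchedVortexRows
open scoped InnerProductSpace Laplacian ContDiff

/-- A `C²` function with compact support on `ℝ²` has `u, Du, D²u` bounded by one constant
(continuity and compact support of the three derivatives). [folklore] -/
theorem exists_coreBound_of_contDiff_two_hasCompactSupport {u : EuclideanSpace ℝ (Fin 2) → ℝ}
    (hu : ContDiff ℝ 2 u) (hus : HasCompactSupport u) :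
    ∃ M : ℝ, ∀ ξ, |u ξ| ≤ M ∧ ‖fderiv ℝ u ξ‖ ≤ M ∧ ‖fderiv ℝ (fderiv ℝ u) ξ‖ ≤ M := by
  obtain ⟨C₀, h₀⟩ := hu.continuous.bounded_above_of_compact_support hus
  obtain ⟨C₁, h₁⟩ := (hu.continuous_fderiv two_ne_zero).bounded_above_of_compact_support
    (hus.fderiv (𝕜 := ℝ))
  have hd1 : ContDiff ℝ 1 (fderiv ℝ u) := hu.fderiv_right (m := 1) le_rfl
  obtain ⟨C₂, h₂⟩ := (hd1.continuous_fderiv one_ne_zero).bounded_above_of_compact_support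
    ((hus.fderiv (𝕜 := ℝ)).fderiv (𝕜 := ℝ))
  refine ⟨max C₀ (max C₁ C₂), fun ξ => ⟨?_, ?_, ?_⟩⟩
  · rw [← Real.norm_eq_abs]
    exact (h₀ ξ).trans (le_max_left _ _)
  · exact (h₁ ξ).trans ((le_max_left _ _).trans (le_max_right _ _))
  · exact (h₂ ξ).trans ((le_max_right _ _).trans (le_max_right _ _))

/-- **The `λ = 0` core bound in ground-state variables** (Gallay–Wayne energy estimate): for
`u ∈ C²_c(ℝ²)` with `∫ G u = 0` and `w = G u`, for every `R : ℝ`,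
`¼ ∫ G⁻¹ w² ≤ ∫ G⁻¹ (Lw − R(⟪v^G, ∇w⟫ + ⟪K∗w, ∇G⟫))²`: `⟨Lw, w⟩_X ≤ −½‖w‖²_X` (spectral gap of `L`
on mass-zero vorticities), `Λ_G` is skew in `X = L²(G⁻¹)`, and `−(Tw)w ≤ (Tw)² + ¼w²` pointwise.
[cite: GallayWayne2005, Prop. 4.1 and Lemma 4.8] -/
theorem coreBoundLamZero_groundState (R : ℝ) {u : EuclideanSpace ℝ (Fin 2) → ℝ}
    (hu : ContDiff ℝ 2 u) (hus : HasCompactSupport u)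
    (hmean : ∫ x, gaussVortexProfile x * u x = 0) :
    (1 / 4 : ℝ) * ∫ x, (gaussVortexProfile x)⁻¹ * (gaussVortexProfile x * u x) ^ 2 ≤
      ∫ x, (gaussVortexProfile x)⁻¹ *
        (strainedVorticityOperator 0 (fun η => gaussVortexProfile η * u η) x -
          R * (⟪gaussVortexVelocity x, gradient (fun η => gaussVortexProfile η * u η) x⟫_ℝ +
            ⟪biotSavart2D (fun η => gaussVortexProfile η * u η) x,
              gradient gaussVortexProfile x⟫_ℝ)) ^ 2 := by
  obtain ⟨M, hM⟩ := exists_coreBound_of_contDiff_two_hasCompactSupport hu hus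
  have hu1 : ContDiff ℝ 1 u := hu.of_le one_le_two
  have h0 : ∀ x, |u x| ≤ M := fun x => (hM x).1
  have h1 : ∀ x, ‖fderiv ℝ u x‖ ≤ M := fun x => (hM x).2.1
  have h2 : ∀ x, ‖fderiv ℝ (fderiv ℝ u) x‖ ≤ M := fun x => (hM x).2.2
  -- the vorticity `w = G u` and the image `f = T_{0,R} w`
  set w : EuclideanSpace ℝ (Fin 2) → ℝ := fun η => gaussVortexProfile η * u η with hw_def
  set f : EuclideanSpace ℝ (Fin 2) → ℝ := fun x => strainedVorticityOperator 0 w x -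
    R * (⟪gaussVortexVelocity x, gradient w x⟫_ℝ +
      ⟪biotSavart2D w x, gradient gaussVortexProfile x⟫_ℝ) with hf_def
  change (1 / 4 : ℝ) * ∫ x, (gaussVortexProfile x)⁻¹ * w x ^ 2 ≤
    ∫ x, (gaussVortexProfile x)⁻¹ * f x ^ 2
  have hw2 : ContDiff ℝ 2 w := (contDiff_gaussVortexProfile (n := 2)).mul hu
  have hw1 : ContDiff ℝ 1 w := hw2.of_le one_le_two
  have hwc : Continuous w := hw2.continuous
  have hws : HasCompactSupport w := hus.mul_left
  have hwi : Integrable w := hwc.integrable_of_hasCompactSupport hws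
  -- Gaussian-class bounds of the pieces
  have hwb : ∀ ξ, |w ξ| ≤ M * (1 + ‖ξ‖) ^ 0 * gaussVortexProfile ξ :=
    abs_gauss_mul_le_of_coreBound hM
  have hwb' : ∀ ξ, |w ξ| ≤ M * gaussVortexProfile ξ := fun ξ =>
    (coreInverse_groundState_bounds u M hu hM ξ).1
  have hDw : ∀ ξ, ‖gradient w ξ‖ ≤ M * (1 + ‖ξ‖) ^ 1 * gaussVortexProfile ξ :=
    norm_gradient_gauss_mul_le_of_coreBound hM (hu.differentiable two_ne_zero)
  have hL : ∀ ξ, |strainedVorticityOperator 0 w ξ| ≤ 3 * M * (1 + ‖ξ‖) ^ 1 * gaussVortexProfile ξ :=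
    abs_strainedVorticityOperator_gauss_mul_le_of_coreBound hM hu
  have hR : ∀ ξ, |⟪gaussVortexVelocity ξ, gradient w ξ⟫_ℝ| ≤
      (1 * M) * (1 + ‖ξ‖) ^ (1 + 1) * gaussVortexProfile ξ :=
    gaussClass_inner_left norm_gaussVortexVelocity_le hDw
  obtain ⟨Kw, hKw⟩ := exists_norm_biotSavart2D_le_of_gaussClass hwc hwb
  have hN : ∀ ξ, |⟪biotSavart2D w ξ, gradient gaussVortexProfile ξ⟫_ℝ| ≤
      (Kw * 1) * (1 + ‖ξ‖) ^ (0 + 1) * gaussVortexProfile ξ :=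
    gaussClass_inner_left hKw norm_gradient_gaussVortexProfile_le
  have hf : ∀ ξ, |f ξ| ≤ (3 * M + |R| * (1 * M + Kw * 1)) * (1 + ‖ξ‖) ^ 2 * gaussVortexProfile ξ :=
    gaussClass_sub (gaussClass_mono (m := 2) (by norm_num) hL)
      (gaussClass_const_mul R (gaussClass_add (gaussClass_mono (m := 2) (by norm_num) hR)
        (gaussClass_mono (m := 2) (by norm_num) hN)))
  -- measurability of the pieces
  have hgw : Continuous (gradient w) := continuous_gradient_of_contDiff hw1
  have hwm : AEStronglyMeasurable w volume := hwc.aestronglyMeasurable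
  have hLm : AEStronglyMeasurable (strainedVorticityOperator 0 w) volume :=
    (continuous_strainedVorticityOperator hw2 0).aestronglyMeasurable
  have hRm : AEStronglyMeasurable (fun ξ => ⟪gaussVortexVelocity ξ, gradient w ξ⟫_ℝ) volume :=
    (continuous_gaussVortexVelocity.inner hgw).aestronglyMeasurable
  have hNm : AEStronglyMeasurable
      (fun ξ => ⟪biotSavart2D w ξ, gradient gaussVortexProfile ξ⟫_ℝ) volume :=
    (aestronglyMeasurable_biotSavart2D hwc).inner
      (continuous_gradient_of_contDiff (contDiff_gaussVortexProfile (n := 1))).aestronglyMeasurable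
  have hfm : AEStronglyMeasurable f volume := hLm.sub ((hRm.add hNm).const_mul R)
  -- absolute convergence of the pairings
  have hIw2 : Integrable fun ξ => (gaussVortexProfile ξ)⁻¹ * w ξ ^ 2 :=
    integrable_invGauss_mul_sq hwm hwb
  have hIf2 : Integrable fun ξ => (gaussVortexProfile ξ)⁻¹ * f ξ ^ 2 :=
    integrable_invGauss_mul_sq hfm hf
  have hIfw : Integrable fun ξ => (gaussVortexProfile ξ)⁻¹ * f ξ * w ξ :=
    integrable_invGauss_mul_mul hfm hwm hf hwb
  have hILw : Integrable fun ξ => (gaussVortexProfile ξ)⁻¹ * strainedVorticityOperator 0 w ξ * w ξ :=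
    integrable_invGauss_mul_mul hLm hwm hL hwb
  have hIRw : Integrable fun ξ =>
      (gaussVortexProfile ξ)⁻¹ * w ξ * ⟪gaussVortexVelocity ξ, gradient w ξ⟫_ℝ :=
    integrable_invGauss_mul_mul hwm hRm hwb hR
  have hINw : Integrable fun ξ =>
      (gaussVortexProfile ξ)⁻¹ * w ξ * ⟪biotSavart2D w ξ, gradient gaussVortexProfile ξ⟫_ℝ :=
    integrable_invGauss_mul_mul hwm hNm hwb hN
  -- (1) ENERGY: `⟨Lw, w⟩_X = -∫ G ‖Du‖² ≤ -½ ‖w‖²_X`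
  have hE : ∫ ξ, (gaussVortexProfile ξ)⁻¹ * strainedVorticityOperator 0 w ξ * w ξ =
      -∫ ξ, gaussVortexProfile ξ * ‖fderiv ℝ u ξ‖ ^ 2 :=
    coreL_energy_identity_of_bounds hu h0 h1 h2
  have hgap : 1 / 2 * ∫ ξ, gaussVortexProfile ξ * u ξ ^ 2 ≤
      ∫ ξ, gaussVortexProfile ξ * ‖fderiv ℝ u ξ‖ ^ 2 :=
    coreL_gap_of_bounds hu1 h0 h1 hmean
  have hXw : ∫ ξ, (gaussVortexProfile ξ)⁻¹ * w ξ ^ 2 = ∫ ξ, gaussVortexProfile ξ * u ξ ^ 2 := by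
    refine integral_congr_ae (Eventually.of_forall fun ξ => ?_)
    have hG : gaussVortexProfile ξ ≠ 0 := (gaussVortexProfile_pos ξ).ne'
    simp only [hw_def]
    field_simp
  have hEnergy : ∫ ξ, (gaussVortexProfile ξ)⁻¹ * strainedVorticityOperator 0 w ξ * w ξ ≤
      -(1 / 2) * ∫ ξ, (gaussVortexProfile ξ)⁻¹ * w ξ ^ 2 := by
    rw [hE, hXw]
    linarith
  -- (2) SKEWNESS of the local rotation `v^G·∇`
  have hSloc : ∫ ξ, (gaussVortexProfile ξ)⁻¹ * w ξ * ⟪gaussVortexVelocity ξ, gradient w ξ⟫_ℝ = 0 :=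
    coreRotation_local_skew u hu1 ⟨M, fun ξ => ⟨(hM ξ).1, (hM ξ).2.1⟩⟩
  -- (3) SKEWNESS of the Biot–Savart part `(K∗w)·∇G`
  have hSnl : ∫ ξ, (gaussVortexProfile ξ)⁻¹ * w ξ *
      ⟪biotSavart2D w ξ, gradient gaussVortexProfile ξ⟫_ℝ = 0 :=
    coreBiotSavart_skew w hwc hwi ⟨M, hwb'⟩
  -- (4) the pairing `⟨Tw, w⟩_X = ⟨Lw, w⟩_X`
  have hI3 : Integrable fun ξ => (gaussVortexProfile ξ)⁻¹ * strainedVorticityOperator 0 w ξ * w ξ -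
      R * ((gaussVortexProfile ξ)⁻¹ * w ξ * ⟪gaussVortexVelocity ξ, gradient w ξ⟫_ℝ) :=
    hILw.sub (hIRw.const_mul R)
  have hpair : ∫ ξ, (gaussVortexProfile ξ)⁻¹ * f ξ * w ξ =
      ∫ ξ, (gaussVortexProfile ξ)⁻¹ * strainedVorticityOperator 0 w ξ * w ξ := by
    have hpt : (fun ξ => (gaussVortexProfile ξ)⁻¹ * f ξ * w ξ) = fun ξ =>
        ((gaussVortexProfile ξ)⁻¹ * strainedVorticityOperator 0 w ξ * w ξ -
          R * ((gaussVortexProfile ξ)⁻¹ * w ξ * ⟪gaussVortexVelocity ξ, gradient w ξ⟫_ℝ)) -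
          R * ((gaussVortexProfile ξ)⁻¹ * w ξ *
            ⟪biotSavart2D w ξ, gradient gaussVortexProfile ξ⟫_ℝ) := by
      funext ξ
      simp only [hf_def]
      ring
    rw [hpt, integral_sub hI3 (hINw.const_mul R), integral_sub hILw (hIRw.const_mul R),
      integral_const_mul, integral_const_mul, hSloc, hSnl]
    ring
  -- (5) AM-GM: `0 ≤ G⁻¹ (f + w/2)² = G⁻¹ f² + G⁻¹ f w + ¼ G⁻¹ w²`
  have hI5 : Integrable fun ξ => (gaussVortexProfile ξ)⁻¹ * f ξ ^ 2 +
      (gaussVortexProfile ξ)⁻¹ * f ξ * w ξ := hIf2.add hIfw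
  have hAM : 0 ≤ ∫ ξ, ((gaussVortexProfile ξ)⁻¹ * f ξ ^ 2 + (gaussVortexProfile ξ)⁻¹ * f ξ * w ξ +
      (1 / 4 : ℝ) * ((gaussVortexProfile ξ)⁻¹ * w ξ ^ 2)) := by
    refine integral_nonneg fun ξ => ?_
    have hG : 0 ≤ (gaussVortexProfile ξ)⁻¹ := inv_nonneg.2 (gaussVortexProfile_pos ξ).le
    have e : (gaussVortexProfile ξ)⁻¹ * f ξ ^ 2 + (gaussVortexProfile ξ)⁻¹ * f ξ * w ξ +
        (1 / 4 : ℝ) * ((gaussVortexProfile ξ)⁻¹ * w ξ ^ 2) =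
        (gaussVortexProfile ξ)⁻¹ * (f ξ + w ξ / 2) ^ 2 := by ring
    simp only [Pi.zero_apply]
    rw [e]
    exact mul_nonneg hG (sq_nonneg _)
  rw [integral_add hI5 (hIw2.const_mul _), integral_add hIf2 hIfw, integral_const_mul, hpair] at hAM
  linarith

/-- **Stub 4 of the skeleton of `CoreLinearInvertibility`, line `Sketch` (`λ = 0`: the Gallay–Wayne
energy estimate, `c = 1/2`, every `R`).** On `C²_c` mass-zero vorticities
`¼ ∫ G⁻¹ w² ≤ ∫ G⁻¹ (T_{0,R} w)²` with `T_{0,R} w = L w − R(⟪v^G, ∇w⟫ + ⟪K_{2D}∗w, ∇G⟫)`,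
`L = strainedVorticityOperator 0`, `G = gaussWeightLam 0 = gaussVortexProfile`: `Λ_G` is skew in
`L²(G⁻¹)` and `⟨Lw, w⟩ ≤ −½‖w‖²` (Gaussian Poincaré), so `−⟨Tw, w⟩ ≥ ½‖w‖²`, and AM–GM.
Reduction to `coreBoundLamZero_groundState` with `u = w/G`. [cite: GallayWayne2005, Prop. 4.1 and Lemma 4.8] -/
theorem stub_coreBoundLamZero :
    ∀ (R : ℝ) (w : EuclideanSpace ℝ (Fin 2) → ℝ), ContDiff ℝ 2 w → HasCompactSupport w →
    ∫ x, w x = 0 →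
    (1 / 4 : ℝ) * ∫ x, (gaussWeightLam 0 x)⁻¹ * w x ^ 2 ≤
      ∫ x, (gaussWeightLam 0 x)⁻¹ * (strainedVorticityOperator 0 w x -
        R * (⟪gaussVortexVelocity x, gradient w x⟫_ℝ +
          ⟪biotSavart2D w x, gradient gaussVortexProfile x⟫_ℝ)) ^ 2 := by
  intro R w hw hws hw0
  obtain ⟨u, hu, hus, rfl⟩ : ∃ u : EuclideanSpace ℝ (Fin 2) → ℝ, ContDiff ℝ 2 u ∧
      HasCompactSupport u ∧ w = fun η => gaussVortexProfile η * u η := by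
    refine ⟨fun x => w x * (gaussVortexProfile x)⁻¹,
      hw.mul (contDiff_gaussVortexProfile.inv fun x => (gaussVortexProfile_pos x).ne'),
      hws.mul_right, ?_⟩
    funext η
    have hG : gaussVortexProfile η ≠ 0 := (gaussVortexProfile_pos η).ne'
    field_simp
  simp only [gaussWeightLam_zero] at hw0 ⊢
  exact coreBoundLamZero_groundState R hu hus hw0

end Summit.NavierStokesRegularity.NavierStokesRegularity.Theorems

end
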